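import Mathlib
import Summits.NavierStokesRegularity.NavierStokesRegularity.Theses.RootDecompFrugalCore
import HarnessLib

/-!
# RootDecompFrugalCore — glue `TameLavishIsTypeI_of_cells` (stmt-NavierStokesRegularity-32094) PROVED

Route N17 `route-NavierStokesRegularity-RootDecompFrugalCore`, the GLUE of the ROUND CORE split (lens-2 g9; writer g4
evidence `GlueProofN17E.lean`, not mounted in this seat's jail — re-proved here on the tree decls):
`TameLavishRoundIsTypeI → TameLavishSkewIsTypeI → TameLavishIsTypeI`. The two cells are the parent with the
ROUND predicate resp. its negation inserted before the conclusion, so the glue is excluded middle. Pure logic;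
Navier–Stokes regularity is NOT proved by anything here (rung 0).
-/

-- the summit and its single sub-problem share the name (CONVENTIONS §1), as in every Theorems file
set_option linter.dupNamespace false

namespace Summit.NavierStokesRegularity.NavierStokesRegularity.Theorems.FrugalCore

open Summit.NavierStokesRegularity.NavierStokesRegularity.Theses.RootDecompFrugalCore

/-- **Glue of the round-core split** (stmt-NavierStokesRegularity-32094): round cell + skew cell ⟹ parent, by
excluded middle on the ROUND predicate. [folklore] -/
theorem tameLavishIsTypeI_of_cells_proof : TameLavishIsTypeI_of_cells := by
  unfold TameLavishIsTypeI_of_cells TameLavishIsTypeI TameLavishRoundIsTypeI TameLavishSkewIsTypeI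
  intro hR hS ν T hν hT u p h₁ h₂ h₃ h₄ h₅ h₆ h₇ h₈
  exact (Classical.em _).elim (fun h => hR ν T hν hT u p h₁ h₂ h₃ h₄ h₅ h₆ h₇ h₈ h)
    (fun h => hS ν T hν hT u p h₁ h₂ h₃ h₄ h₅ h₆ h₇ h₈ h)

/-- **Exactness of the round-core split**: parent ↔ round cell ∧ skew cell. [folklore] -/
theorem tameLavishIsTypeI_iff_cells :
    TameLavishIsTypeI ↔ TameLavishRoundIsTypeI ∧ TameLavishSkewIsTypeI := by
  constructor
  · intro h
    refine ⟨?_, ?_⟩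
    · intro ν T hν hT u p h₁ h₂ h₃ h₄ h₅ h₆ h₇ h₈ _
      exact h ν T hν hT u p h₁ h₂ h₃ h₄ h₅ h₆ h₇ h₈
    · intro ν T hν hT u p h₁ h₂ h₃ h₄ h₅ h₆ h₇ h₈ _
      exact h ν T hν hT u p h₁ h₂ h₃ h₄ h₅ h₆ h₇ h₈
  · rintro ⟨hR, hS⟩
    exact tameLavishIsTypeI_of_cells_proof hR hS

end Summit.NavierStokesRegularity.NavierStokesRegularity.Theorems.FrugalCore
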